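/-
Origin: expansion seat `planner-pub-hodgecm-mc-sanity-1-0`, handover #2r 2026-08-18T18:55Z md5 debdada8bc2c9ab1dd88541eb599b63b SUPERSEDES 1d828dd84bf2 (doc-only; NEW additive leaf, 143 l.; imports HodgeCM.Model.Sanity.DegenerateCores only) (`HOME/mc/pub-hodgecm-mc-sanity-1/lean/OffRegimeRank.lean`, md5 debdada8, 143 lines);
landed by the packager successor (mc-unitary-1-g3, gen-8 kit) in gate run 32 as `HodgeCM/Model/Sanity/OffRegimeRank.lean` (verbatim).
-/
/-
HodgeCM / MODEL-CONSTRUCTION sub-cell (pub-hodgecm), node SAN — construction prover `pub-hodgecm-mc-sanity-1`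
(seat planner-pub-hodgecm-mc-sanity-1-0), 2026-08-18.  Intended PKG path: `HodgeCM/Model/Sanity/OffRegimeRank.lean`.
Imports `Sanity/DegenerateCores.lean` (this seat) only; nothing restated, no new axioms, no hypotheses records, 0 proof holes.
-/
import Summits.HodgeConjecture.HodgeCM.Model.Sanity.DegenerateCores

/-!
# Sanity: the unguarded Petersson input C2 forces Petersson RANK ≤ 1 off the anisotropic regime

KERNEL form of the MODEL-SCOPE A.3 corner (rows h09a/h09b "CORNER", re-typing R1; carver ruling J-G0-1), for ANY universe
`U` and ANY core `C : U.AdelicThetaCore hP`: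

C2 `Fact_innerEmb` quantifies over ALL contexts `(L, ι₁, V, Γ)`.  At a context with `V.Hm` NOT anisotropic the
modelled adelic quotient `[G_U] = G ⧸ Γ` of `V.latticeModel hP` is ONE point (`DegenerateCores` §5,
`subsingleton_quotient_of_not_isAnisotropic`, from PKG `Adelic.eq_one_of_not_isAnisotropic`), so the target
`H_V = L²(G ⧸ Γ, ν)` of `emb Γ` has dimension ≤ 1 (`Lp_inner_gram_eq_of_subsingleton`: any two `L²` "functions on a
point" have vanishing Gram determinant).  Transporting through C2's identity `⟪emb η', emb η⟫ = c_Γ · tr_ℂ(η ∪ η̄')`,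
`c_Γ ≠ 0`:

**`petersson_gram_eq_of_innerEmb`**: C2 ⇒ for every off-regime context and all `η₁, η₂ ∈ F²H²(P_Γ)`,
`P(η₁,η₁) · P(η₂,η₂) = P(η₁,η₂) · P(η₂,η₁)` where `P(η,η') := tr_ℂ(η ∪ η̄')` — the Petersson form has RANK ≤ 1 on
`F²H²` of every off-regime period surface.  Equivalently (`not_innerEmb_of_petersson_gram_ne`): a universe whose `pms`
at ONE off-regime context carries two `F²`-classes with non-vanishing Petersson Gram determinant allows NO core
satisfying C2 — whatever `emb`, `cover`, `wm`, `Theta` are.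

Reading for G0 (the model universe term) / J-G0-1: the "lawful escape" `pms :=` a surface with `H^{2,0} = 0` off-regime
is sufficient but not necessary — the exact kernel obligation is Petersson rank ≤ 1 on `F²H²(pms L ι₁ V Γ)` at every
`(L, ι₁, V)` with `¬ IsAnisotropic L V.Hm` (in particular at every imaginary-quadratic `L`, where an indefinite hermitian
3-space is isotropic); OR C2 is re-typed with the regime guard (MODEL-SCOPE R1).
-/

set_option autoImplicit false

noncomputable section

open HodgeCM HodgeCM.Universe MeasureTheory
open scoped InnerProductSpace ENNReal
open Literature.AlgebraicGeometry.Motives (HodgeStructure)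
open Literature.AlgebraicGeometry.Motives.HodgeStructure (conj)

attribute [-instance] Quotient.instMeasurableSpace

namespace HodgeCM

/-! ## §1 `L²` of a one-point space has dimension ≤ 1 -/

section Subsingleton

variable {α : Type*} [MeasurableSpace α] [Subsingleton α] {μ : Measure α}

/-- On a subsingleton, two `L²` classes whose representative values agree at one point are equal. -/
theorem Lp_eq_smul_of_subsingleton (f g : Lp ℂ 2 μ) (x₀ : α) (hf : (f : α → ℂ) x₀ ≠ 0) :
    g = ((g : α → ℂ) x₀ / (f : α → ℂ) x₀) • f := by
  refine Lp.ext ?_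
  filter_upwards [Lp.coeFn_smul (((g : α → ℂ) x₀ / (f : α → ℂ) x₀)) f] with x hx
  rw [hx, Pi.smul_apply, smul_eq_mul, Subsingleton.elim x x₀, div_mul_cancel₀ _ hf]

/-- On a subsingleton, an `L²` class whose representative vanishes at one point is zero. -/
theorem Lp_eq_zero_of_subsingleton (f : Lp ℂ 2 μ) (x₀ : α) (hf : (f : α → ℂ) x₀ = 0) : f = 0 := by
  refine Lp.ext ?_
  filter_upwards [Lp.coeFn_zero ℂ 2 μ] with x hx
  rw [hx, Pi.zero_apply, Subsingleton.elim x x₀, hf]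

/-- **Vanishing Gram determinant in `L²` of a (sub)singleton**: `⟪f,f⟫⟪g,g⟫ = ⟪f,g⟫⟪g,f⟫`. -/
theorem Lp_inner_gram_eq_of_subsingleton (f g : Lp ℂ 2 μ) :
    ⟪f, f⟫_ℂ * ⟪g, g⟫_ℂ = ⟪f, g⟫_ℂ * ⟪g, f⟫_ℂ := by
  rcases isEmpty_or_nonempty α with hα | ⟨⟨x₀⟩⟩
  · have hf : f = 0 := Lp.ext (Filter.Eventually.of_forall fun x => (IsEmpty.false x).elim)
    simp [hf]
  · by_cases hf : (f : α → ℂ) x₀ = 0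
    · simp [Lp_eq_zero_of_subsingleton f x₀ hf]
    · rw [Lp_eq_smul_of_subsingleton f g x₀ hf]
      simp only [inner_smul_left, inner_smul_right]
      ring

end Subsingleton

/-! ## §2 C2 off the anisotropic regime -/

namespace Universe.AdelicThetaCore

variable {U : Universe} {hP : PrintFact_unitaryCompact} (C : U.AdelicThetaCore hP) (h : Bool)
variable (d12 d34 : ∀ {L : CMField}, SeesawCtx L → SideData L)

/-- Off the anisotropic regime the target Hilbert space `H_V = L²([G_U])` of `emb` has vanishing Gram determinants. -/
theorem inner_gram_eq_of_not_isAnisotropic {L : CMField} {ι₁ : L →+* ℂ} (V : HermSpace3 L ι₁)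
    (hV : ¬ IsAnisotropic L V.Hm) (u v : (V.latticeModel hP).toQuotientModel.H) :
    ⟪u, u⟫_ℂ * ⟪v, v⟫_ℂ = ⟪u, v⟫_ℂ * ⟪v, u⟫_ℂ := by
  haveI := subsingleton_quotient_of_not_isAnisotropic (hP := hP) V hV
  exact Lp_inner_gram_eq_of_subsingleton u v

variable {C}

/-- **C2 ⇒ Petersson rank ≤ 1 off-regime.**  If the END STATE satisfies `Fact_innerEmb`, then at every context with
`V.Hm` not anisotropic and all `η₁, η₂ ∈ F²H²(P_Γ)` the Petersson Gram determinant vanishes: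
`P(η₁,η₁)P(η₂,η₂) = P(η₁,η₂)P(η₂,η₁)`, `P(η,η') = tr_ℂ(η ∪ η̄')`. -/
theorem petersson_gram_eq_of_innerEmb (hC2 : (C.thetaModel h d12 d34).Fact_innerEmb) {L : CMField} {ι₁ : L →+* ℂ}
    (V : HermSpace3 L ι₁) (hV : ¬ IsAnisotropic L V.Hm) (Γ : Level V) (η₁ η₂ : U.CohC (U.pms L ι₁ V Γ) 2)
    (h₁ : η₁ ∈ (U.hodge (U.pms L ι₁ V Γ) 2).F 2) (h₂ : η₂ ∈ (U.hodge (U.pms L ι₁ V Γ) 2).F 2) :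
    U.trC (U.pms L ι₁ V Γ) 4 (U.cup2C (U.pms L ι₁ V Γ) 2 η₁ (conj η₁)) *
        U.trC (U.pms L ι₁ V Γ) 4 (U.cup2C (U.pms L ι₁ V Γ) 2 η₂ (conj η₂)) =
      U.trC (U.pms L ι₁ V Γ) 4 (U.cup2C (U.pms L ι₁ V Γ) 2 η₁ (conj η₂)) *
        U.trC (U.pms L ι₁ V Γ) 4 (U.cup2C (U.pms L ι₁ V Γ) 2 η₂ (conj η₁)) := by
  rw [C.thetaModel_innerEmb_iff h d12 d34] at hC2
  obtain ⟨a, ha, H⟩ := hC2 Γ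
  -- P(η, η') = a⁻¹ ⟪emb η', emb η⟫
  have hPet : ∀ η η', η ∈ (U.hodge (U.pms L ι₁ V Γ) 2).F 2 → η' ∈ (U.hodge (U.pms L ι₁ V Γ) 2).F 2 →
      U.trC (U.pms L ι₁ V Γ) 4 (U.cup2C (U.pms L ι₁ V Γ) 2 η (conj η')) = a⁻¹ * ⟪C.emb Γ η', C.emb Γ η⟫_ℂ :=
    fun η η' hη hη' => by rw [H η η' hη hη', ← mul_assoc, inv_mul_cancel₀ ha, one_mul]
  rw [hPet η₁ η₁ h₁ h₁, hPet η₂ η₂ h₂ h₂, hPet η₁ η₂ h₁ h₂, hPet η₂ η₁ h₂ h₁]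
  have hg := inner_gram_eq_of_not_isAnisotropic (hP := hP) V hV (C.emb Γ η₁) (C.emb Γ η₂)
  linear_combination (a⁻¹ * a⁻¹) * hg

/-- **Contrapositive, for the universe builders (G0 / J-G0-1)**: if at ONE off-regime context the period surface carries
two `F²`-classes with NON-vanishing Petersson Gram determinant, then NO core over `U` satisfies C2. -/
theorem not_innerEmb_of_petersson_gram_ne {L : CMField} {ι₁ : L →+* ℂ} (V : HermSpace3 L ι₁)
    (hV : ¬ IsAnisotropic L V.Hm) (Γ : Level V) (η₁ η₂ : U.CohC (U.pms L ι₁ V Γ) 2)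
    (h₁ : η₁ ∈ (U.hodge (U.pms L ι₁ V Γ) 2).F 2) (h₂ : η₂ ∈ (U.hodge (U.pms L ι₁ V Γ) 2).F 2)
    (hne : U.trC (U.pms L ι₁ V Γ) 4 (U.cup2C (U.pms L ι₁ V Γ) 2 η₁ (conj η₁)) *
        U.trC (U.pms L ι₁ V Γ) 4 (U.cup2C (U.pms L ι₁ V Γ) 2 η₂ (conj η₂)) ≠
      U.trC (U.pms L ι₁ V Γ) 4 (U.cup2C (U.pms L ι₁ V Γ) 2 η₁ (conj η₂)) *
        U.trC (U.pms L ι₁ V Γ) 4 (U.cup2C (U.pms L ι₁ V Γ) 2 η₂ (conj η₁)))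
    (C : U.AdelicThetaCore hP) : ¬ (C.thetaModel h d12 d34).Fact_innerEmb :=
  fun hC2 => hne (petersson_gram_eq_of_innerEmb h d12 d34 hC2 V hV Γ η₁ η₂ h₁ h₂)

/-- In particular (one class): C2 ⇒ nothing; but two Petersson-ORTHOGONAL classes of nonzero Petersson norm at an
off-regime context refute C2 for every core. -/
theorem not_innerEmb_of_petersson_orthogonal {L : CMField} {ι₁ : L →+* ℂ} (V : HermSpace3 L ι₁)
    (hV : ¬ IsAnisotropic L V.Hm) (Γ : Level V) (η₁ η₂ : U.CohC (U.pms L ι₁ V Γ) 2)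
    (h₁ : η₁ ∈ (U.hodge (U.pms L ι₁ V Γ) 2).F 2) (h₂ : η₂ ∈ (U.hodge (U.pms L ι₁ V Γ) 2).F 2)
    (hn₁ : U.trC (U.pms L ι₁ V Γ) 4 (U.cup2C (U.pms L ι₁ V Γ) 2 η₁ (conj η₁)) ≠ 0)
    (hn₂ : U.trC (U.pms L ι₁ V Γ) 4 (U.cup2C (U.pms L ι₁ V Γ) 2 η₂ (conj η₂)) ≠ 0)
    (horth : U.trC (U.pms L ι₁ V Γ) 4 (U.cup2C (U.pms L ι₁ V Γ) 2 η₁ (conj η₂)) = 0)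
    (C : U.AdelicThetaCore hP) : ¬ (C.thetaModel h d12 d34).Fact_innerEmb :=
  not_innerEmb_of_petersson_gram_ne h d12 d34 V hV Γ η₁ η₂ h₁ h₂
    (by rw [horth, zero_mul]; exact mul_ne_zero hn₁ hn₂) C

end Universe.AdelicThetaCore

end HodgeCM

end
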